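import Literature.LinearAlgebra.Matrix.IntegerBlockCompanionMatrices
import Literature.RingTheory.DedekindDomain.LatticeSteinitzClass
import Mathlib.RingTheory.Ideal.Norm.AbsNorm
import Mathlib.RingTheory.AlgebraTower
import HarnessLib

/-!
# The classes of `T`-stable lattices, III: the Steinitz class of the hull is a class invariant, every ideal class
# occurs — **at least `h_K` classes** (O'Meara 81:8; Marseglia 2025 (ANTS XVI) Prop. 3.1 «uniquely determined by …
# the isomorphism class of `I`», Cor. 3.7 «divisible by `#Pic(𝒪)`», weak form)

[topic LinearAlgebra/Matrix] Lane `lit-hodgefound` (Track 2 foundations library), seat p15 generation 38, row g38-#7 —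
the LOWER BOUND companion of g38-#4 `StableLatticeClassesIrreducible` (finiteness) and g38-#6 (non-vacuity).
THEOREMS ONLY (no definition, no instance, no named fact; D-0026 net Literature debt `0`; no `sorry`).  The Steinitz
class machinery is the tree's (`Literature.RingTheory.DedekindDomain.Lattice.classGroupMk_prod_eq_of_pseudoBasis`,
O'Meara 81:8; `fg_and_span_eq_top_of_pseudoBasis`), used by name.

## Sources, VERBATIM

S. Marseglia, *Modules over orders, conjugacy classes of integral matrices, and abelian varieties over finite fields*,
Res. Number Theory 11 (2025) (ANTS XVI) [Marseglia2025ModulesOverOrders], §3 (held `paper:arxiv-2208.05409`, chunks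
p0006–p0007): **Proposition 3.1.** «Let `M` be in `𝓛(𝒪, V)`. Then there are fractional `𝒪_i`-ideals `I_i` and there
exists an `𝒪`-linear isomorphism `M ≃ ⊕_{i=1}^n (𝒪_i^{s_i−1} ⊕ I_i)`. Moreover, the isomorphism class of `M` is
uniquely determined by the integers `s_i` and the isomorphism class of the fractional `𝒪`-ideal `I = I₁ ⊕ … ⊕ I_n`.»
(the morphisms of `𝓛(R, V)` «extend uniquely to a `K`-linear endomorphism of `V`», so an `R`-isomorphism `M ≃ M′`
carries `M𝒪` onto `M′𝒪`); **Corollary 3.7.** «The number of isomorphism classes in `𝓛(R, V)` is divisible by the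
size of `Pic(𝒪)`.»  O. T. O'Meara, *Introduction to Quadratic Forms* [Omeara1963], §81C 81:8 (the class
`[𝔞₁⋯𝔞ₙ]` of a pseudo-basis does not depend on the pseudo-basis).

## What is formalised (one number field `K`, `n = 1` of the source, `V = W` a `K`-space of dimension `s ≥ 1`)

* §1 transport of a pseudo-basis along a `K`-linear automorphism and **the Steinitz class of a lattice is invariant
  under `GL_K(W)`** (`pseudoBasis_map`, `classGroupMk_eq_of_linearEquiv`); the hull commutes with `GL_K(W)`
  (`mem_span_iff_map_mem_span`).
* §2 **THE LOWER BOUND** `card_classGroup_le_natCard_quot`: for `K = ℚ(θ)`, `θ` integral, and `W ≠ 0`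
  finite-dimensional over `K`, **`h_K ≤ #{θ-stable full ℤ-lattices of W}/GL_K(W)`** — the Steinitz class of the
  hull `M𝒪_K` descends to the classes (§1) and is onto: the ideal class `[I]` is the class of the `𝒪_K`-lattice
  `𝒪_K b₁ ⊕ ⋯ ⊕ 𝒪_K b_{s−1} ⊕ I b_s`.  This is the weak form («`≥`», for the classes counted with ALL of `GL_K(W)`)
  of Cor. 3.7; `-- TODO(general form): divisibility #classes ≡ 0 mod #Pic(𝒪)` needs Lemma 3.4's lifting.
* §3 endomorphism language `card_classGroup_le_natCard_quot_centralizer`: for `T` with `P(T) = 0`, `P` irreducible,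
  `c(T) = 0` (`c ∈ ℤ[x]` monic) on `W ≠ 0`: `h_{ℚ[x]/(P)} ≤ #{T-stable full ℤ-lattices}/C(T)`; with g38-#3, for any
  such model of `χ = c`: `h_{ℚ[x]/(P)} ≤ #(𝓜/∼_ℤ)` (`card_classGroup_le_natCard_quot_conj`), and MODEL-FREE for
  `χ = P^{s+1}` through g38-#6's integer block-companion matrix (`card_classGroup_le_natCard_quot_conj_pow`) — for
  `s = 0`, `ℤ[θ] = 𝒪_K` this is the Latimer–MacDuffee–Taussky count `#classes = h_K` from below.

## References
* [Marseglia2025ModulesOverOrders] S. Marseglia, Res. Number Theory 11 (2025), §3 Prop. 3.1, Thm. 3.2, Cor. 3.7. [cite: Marseglia2025ModulesOverOrders, §3 Prop. 3.1 and Cor. 3.7, chunks p0006–p0007]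
* [Omeara1963] O. T. O'Meara, *Introduction to Quadratic Forms*, §81C Prop. 81:8, pp. 213–214.
* [Taussky1949] O. Taussky, *On a theorem of Latimer and MacDuffee*, Canad. J. Math. 1 (1949).
* [HertlingLarabi2026b] C. Hertling, K. Larabi, arXiv:2602.15748, §1, Thm. 6.2.
-/

noncomputable section

open scoped Classical nonZeroDivisors NumberField
open Polynomial Module Submodule

namespace Literature.LinearAlgebra.Matrix.StableLatticeClassesLowerBound

open Literature.LinearAlgebra.Matrix.StableLatticeClassesIrreducible
  (exists_basis_pseudoBasis_span finite_quot_linearEquiv_of_smul_mem)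
open Literature.RingTheory.DedekindDomain

/-! ## §1 The Steinitz class of a lattice is a `GL_K(W)`-invariant -/

section Invariance

variable {K : Type} [Field K] [NumberField K]
variable {W : Type*} [AddCommGroup W] [Module K W]

/-- Transport of a pseudo-basis along `f ∈ GL_K(W)`: if `N = Σ 𝔞ᵢbᵢ` and `f(N) = N′` then `N′ = Σ 𝔞ᵢ f(bᵢ)`.
[cite: Marseglia2025ModulesOverOrders, §3 Thm. 3.2 (proof: «Define `M′ = φ(M)`. Part 2 follows from the definition of `M′`»), chunk p0006] -/
theorem pseudoBasis_map [Module (𝓞 K) W] [IsScalarTower (𝓞 K) K W] {n : ℕ} {N N' : Submodule (𝓞 K) W}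
    (b : Basis (Fin n) K W) (𝔞 : Fin n → (FractionalIdeal (𝓞 K)⁰ K)ˣ)
    (hN : ∀ v : W, v ∈ N ↔
      ∃ c : Fin n → K, (∀ i, c i ∈ (𝔞 i : FractionalIdeal (𝓞 K)⁰ K)) ∧ v = ∑ i, c i • b i)
    (f : W ≃ₗ[K] W) (hf : ∀ v : W, v ∈ N ↔ f v ∈ N') (v : W) :
    v ∈ N' ↔ ∃ c : Fin n → K, (∀ i, c i ∈ (𝔞 i : FractionalIdeal (𝓞 K)⁰ K)) ∧ v = ∑ i, c i • (b.map f) i := by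
  have h1 : v ∈ N' ↔ f.symm v ∈ N := by rw [hf, LinearEquiv.apply_symm_apply]
  rw [h1, hN]
  refine exists_congr fun c => and_congr_right fun _ => ?_
  rw [LinearEquiv.symm_apply_eq, map_sum]
  simp_rw [map_smul, Basis.map_apply]

/-- **The Steinitz class `[𝔞₁⋯𝔞ₙ]` of the hull is an invariant of the `GL_K(W)`-orbit** («the isomorphism class of
`M` is uniquely determined by … the isomorphism class of `I`», through O'Meara 81:8: two pseudo-bases of one lattice
have the same class). [cite: Marseglia2025ModulesOverOrders, §3 Prop. 3.1 («Moreover …»), chunk p0006] [cite: Omeara1963, §81C Prop. 81:8, pp. 213–214] -/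
theorem classGroupMk_eq_of_linearEquiv [Module (𝓞 K) W] [IsScalarTower (𝓞 K) K W] {n : ℕ}
    {N N' : Submodule (𝓞 K) W} (b b' : Basis (Fin n) K W) (𝔞 𝔞' : Fin n → (FractionalIdeal (𝓞 K)⁰ K)ˣ)
    (hN : ∀ v : W, v ∈ N ↔
      ∃ c : Fin n → K, (∀ i, c i ∈ (𝔞 i : FractionalIdeal (𝓞 K)⁰ K)) ∧ v = ∑ i, c i • b i)
    (hN' : ∀ v : W, v ∈ N' ↔
      ∃ c : Fin n → K, (∀ i, c i ∈ (𝔞' i : FractionalIdeal (𝓞 K)⁰ K)) ∧ v = ∑ i, c i • b' i)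
    (f : W ≃ₗ[K] W) (hf : ∀ v : W, v ∈ N ↔ f v ∈ N') :
    ClassGroup.mk K (∏ i, 𝔞 i) = ClassGroup.mk K (∏ i, 𝔞' i) :=
  Lattice.classGroupMk_prod_eq_of_pseudoBasis 𝔞 𝔞' (b.map f).linearIndependent b'.linearIndependent
    (pseudoBasis_map b 𝔞 hN f hf) hN'

omit [NumberField K] in
/-- The hull commutes with `GL_K(W)`: `v ∈ M𝒪 ↔ f v ∈ f(M)𝒪`. [cite: Marseglia2025ModulesOverOrders, §3 Thm. 3.2 (proof, «`M′𝒪 = φ(M𝒪)`»), chunk p0006] -/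
theorem mem_span_iff_map_mem_span [Module (𝓞 K) W] [IsScalarTower (𝓞 K) K W] (M : Submodule ℤ W)
    (f : W ≃ₗ[K] W) (v : W) :
    v ∈ Submodule.span (𝓞 K) (M : Set W) ↔
      f v ∈ Submodule.span (𝓞 K) ((M.map ((f : W →ₗ[K] W).restrictScalars ℤ) : Submodule ℤ W) : Set W) := by
  have h1 : ((M.map ((f : W →ₗ[K] W).restrictScalars ℤ) : Submodule ℤ W) : Set W) =
      ((f : W →ₗ[K] W).restrictScalars (𝓞 K)) '' (M : Set W) := Submodule.map_coe _ _
  rw [h1, Submodule.span_image]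
  constructor
  · exact fun hv => Submodule.mem_map_of_mem hv
  · rintro ⟨y, hy, hfy⟩
    have hyv : y = v := f.injective hfy
    exact hyv ▸ hy

end Invariance

/-! ## §2 At least `h_K` classes -/

section LowerBound

variable {K : Type} [Field K] [NumberField K]
variable {W : Type*} [AddCommGroup W] [Module K W] [Module ℚ W] [IsScalarTower ℚ K W] [FiniteDimensional ℚ W]

/-- **AT LEAST `h_K` CLASSES (Prop. 3.1 «uniquely determined by … the class of `I`» + every class occurs; the weak
form of Cor. 3.7).**  For a number field `K = ℚ(θ)`, `θ` an algebraic integer, and a non-zero finite-dimensional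
`K`-space `W`, the `θ`-stable full `ℤ`-lattices of `W` modulo `GL_K(W)` number **at least the class number `h_K`**:
the Steinitz class of the hull `M𝒪_K` is constant on orbits and takes every value (`[I]` at
`𝒪_K b₁ ⊕ ⋯ ⊕ 𝒪_K b_{s−1} ⊕ I b_s`). [cite: Marseglia2025ModulesOverOrders, §3 Prop. 3.1 and Cor. 3.7 (weak form), chunks p0006–p0007] [cite: Omeara1963, §81C Prop. 81:8] -/
theorem card_classGroup_le_natCard_quot [Nontrivial W] {θ : K} (hθ : IsIntegral ℤ θ)
    (hgen : Algebra.adjoin ℚ {θ} = ⊤) :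
    Fintype.card (ClassGroup (𝓞 K)) ≤
      Nat.card (Quot (fun M M' : {M : Submodule ℤ W // M.IsLattice ℚ ∧ ∀ x ∈ M, θ • x ∈ M} =>
        ∃ φ : W ≃ₗ[K] W, M.1.map ((φ : W →ₗ[K] W).restrictScalars ℤ) = M'.1)) := by
  classical
  -- TODO(general form): Marseglia Cor. 3.7 — the number of classes is DIVISIBLE by `#Pic(𝒪)` (needs Lemma 3.4).
  letI : Module (𝓞 K) W := Module.compHom W (algebraMap (𝓞 K) K)
  haveI : IsScalarTower (𝓞 K) K W := IsScalarTower.of_algebraMap_smul fun _ _ => rfl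
  haveI : Module.Finite K W := Module.Finite.of_restrictScalars_finite ℚ K W
  haveI := finite_quot_linearEquiv_of_smul_mem (W := W) hθ hgen
  -- the Steinitz class of the hull
  have hull : ∀ M : {M : Submodule ℤ W // M.IsLattice ℚ ∧ ∀ x ∈ M, θ • x ∈ M},
      ∃ (b : Basis (Fin (finrank K W)) K W) (𝔞 : Fin (finrank K W) → (FractionalIdeal (𝓞 K)⁰ K)ˣ),
      ∀ v : W, v ∈ Submodule.span (𝓞 K) (M.1 : Set W) ↔
        ∃ c : Fin (finrank K W) → K, (∀ i, c i ∈ ((𝔞 i : FractionalIdeal (𝓞 K)⁰ K))) ∧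
          v = ∑ i, c i • b i := fun M => exists_basis_pseudoBasis_span M.2.1
  choose b 𝔞 hb using hull
  let κ : {M : Submodule ℤ W // M.IsLattice ℚ ∧ ∀ x ∈ M, θ • x ∈ M} → ClassGroup (𝓞 K) :=
    fun M => ClassGroup.mk K (∏ i, 𝔞 M i)
  -- §1: it descends to the classes
  have hκ : ∀ M M' : {M : Submodule ℤ W // M.IsLattice ℚ ∧ ∀ x ∈ M, θ • x ∈ M},
      (∃ φ : W ≃ₗ[K] W, M.1.map ((φ : W →ₗ[K] W).restrictScalars ℤ) = M'.1) → κ M = κ M' := by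
    rintro M M' ⟨f, hf⟩
    have hf' : ∀ v, v ∈ Submodule.span (𝓞 K) (M.1 : Set W) ↔ f v ∈ Submodule.span (𝓞 K) (M'.1 : Set W) := by
      intro v
      rw [← hf]
      exact mem_span_iff_map_mem_span M.1 f v
    exact classGroupMk_eq_of_linearEquiv (b M) (b M') (𝔞 M) (𝔞 M') (hb M) (hb M') f hf'
  -- every ideal class occurs
  have hsurj : Function.Surjective (Quot.lift κ hκ) := by
    intro cl
    obtain ⟨I, hI⟩ := ClassGroup.mk0_surjective cl
    have hn : 0 < finrank K W := Module.finrank_pos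
    let i₀ : Fin (finrank K W) := ⟨0, hn⟩
    let B : Basis (Fin (finrank K W)) K W := Module.finBasis K W
    let 𝔠 : Fin (finrank K W) → (FractionalIdeal (𝓞 K)⁰ K)ˣ :=
      Function.update (fun _ => 1) i₀ (FractionalIdeal.mk0 K I)
    -- the `𝒪_K`-lattice `N = Σ 𝔠ᵢ Bᵢ = 𝒪B₁ ⊕ ⋯ ⊕ I B_{i₀} ⊕ ⋯`
    let N : Submodule (𝓞 K) W :=
      { carrier := {v | ∀ i, B.repr v i ∈ ((𝔠 i : FractionalIdeal (𝓞 K)⁰ K) : Submodule (𝓞 K) K)}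
        add_mem' := fun {v w} hv hw i => by
          rw [map_add, Finsupp.add_apply]
          exact add_mem (hv i) (hw i)
        zero_mem' := fun i => by
          rw [map_zero, Finsupp.zero_apply]
          exact zero_mem _
        smul_mem' := fun a v hv i => by
          rw [show a • v = (algebraMap (𝓞 K) K a) • v from rfl, map_smul, Finsupp.smul_apply, smul_eq_mul,
            ← Algebra.smul_def]
          exact Submodule.smul_mem _ a (hv i) }
    have hN : ∀ v : W, v ∈ N ↔
        ∃ c : Fin (finrank K W) → K, (∀ i, c i ∈ (𝔠 i : FractionalIdeal (𝓞 K)⁰ K)) ∧ v = ∑ i, c i • B i := by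
      intro v
      constructor
      · intro hv
        exact ⟨fun i => B.repr v i, fun i => hv i, (B.sum_repr v).symm⟩
      · rintro ⟨c, hc, rfl⟩ i
        show B.repr (∑ i, c i • B i) i ∈ (𝔠 i : FractionalIdeal (𝓞 K)⁰ K)
        rw [B.repr_sum_self]
        exact hc i
    -- it is a `θ`-stable full `ℤ`-lattice
    have hθO : θ ∈ integralClosure ℤ K := (mem_integralClosure_iff ℤ K).2 hθ
    have hNθ : ∀ x ∈ N.restrictScalars ℤ, θ • x ∈ N.restrictScalars ℤ := fun x hx =>
      N.smul_mem ⟨θ, hθO⟩ hx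
    have hI0 : (I : Ideal (𝓞 K)) ≠ ⊥ := nonZeroDivisors.ne_zero I.2
    have hd0 : Ideal.absNorm (I : Ideal (𝓞 K)) ≠ 0 := by
      rw [Ne, Ideal.absNorm_eq_zero_iff]; exact hI0
    have hdI : ((Ideal.absNorm (I : Ideal (𝓞 K)) : ℕ) : 𝓞 K) ∈ (I : Ideal (𝓞 K)) := Ideal.absNorm_mem _
    have h𝔠 : ∀ i (a : 𝓞 K), a ∈ (I : Ideal (𝓞 K)) →
        algebraMap (𝓞 K) K a ∈ (𝔠 i : FractionalIdeal (𝓞 K)⁰ K) := by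
      intro i a ha
      by_cases hi : i = i₀
      · subst hi
        simp only [𝔠, Function.update_self, FractionalIdeal.coe_mk0]
        exact (FractionalIdeal.mem_coeIdeal (𝓞 K)⁰).mpr ⟨a, ha, rfl⟩
      · simp only [𝔠, Function.update_of_ne hi]
        exact (FractionalIdeal.mem_one_iff (𝓞 K)⁰).mpr ⟨a, rfl⟩
    have hNlat : (N.restrictScalars ℤ).IsLattice ℚ := by
      refine ⟨(Lattice.fg_and_span_eq_top_of_pseudoBasis B 𝔠 N hN).1.restrictScalars, ?_⟩
      -- `ℚ`-span: the `ℚ`-basis `ω_j • B_i` of `W` lies in `ℚ · N`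
      rw [← top_le_iff, ← ((NumberField.integralBasis K).smulTower B).span_eq, Submodule.span_le]
      rintro _ ⟨⟨j, i⟩, rfl⟩
      rw [Basis.smulTower_apply, NumberField.integralBasis_apply]
      set ω : 𝓞 K := NumberField.RingOfIntegers.basis K j
      set d : ℕ := Ideal.absNorm (I : Ideal (𝓞 K))
      -- `(d ω) • B i ∈ N`
      have hmem : (algebraMap (𝓞 K) K (ω * (d : 𝓞 K))) • B i ∈ N := by
        intro i'
        rw [map_smul, Basis.repr_self, Finsupp.smul_apply, Finsupp.single_apply]
        split_ifs with h
        · rw [smul_eq_mul, mul_one]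
          exact h𝔠 i' _ (Ideal.mul_mem_left _ ω hdI)
        · rw [smul_zero]; exact zero_mem _
      have hsmul : (algebraMap (𝓞 K) K (ω * (d : 𝓞 K))) • B i = (d : ℚ) • ((algebraMap (𝓞 K) K ω) • B i) := by
        rw [map_mul, map_natCast, mul_comm, mul_smul, Nat.cast_smul_eq_nsmul K, ← Nat.cast_smul_eq_nsmul ℚ]
      have hdQ : (d : ℚ) ≠ 0 := Nat.cast_ne_zero.mpr hd0
      rw [← inv_smul_smul₀ hdQ ((algebraMap (𝓞 K) K ω) • B i)]
      refine Submodule.smul_mem _ _ (Submodule.subset_span ?_)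
      show (d : ℚ) • ((algebraMap (𝓞 K) K ω) • B i) ∈ N
      rw [← hsmul]
      exact hmem
    let X₀ : {M : Submodule ℤ W // M.IsLattice ℚ ∧ ∀ x ∈ M, θ • x ∈ M} := ⟨N.restrictScalars ℤ, hNlat, hNθ⟩
    refine ⟨Quot.mk _ X₀, ?_⟩
    -- its Steinitz class is `[∏ 𝔠] = [I]`
    change κ X₀ = cl
    have hspan : Submodule.span (𝓞 K) ((N.restrictScalars ℤ : Submodule ℤ W) : Set W) = N :=
      le_antisymm (Submodule.span_le.mpr fun v hv => hv) fun v hv => Submodule.subset_span hv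
    have hmemN : ∀ v, v ∈ Submodule.span (𝓞 K) ((N.restrictScalars ℤ : Submodule ℤ W) : Set W) ↔ v ∈ N :=
      fun v => by rw [hspan]
    have h1 : ClassGroup.mk K (∏ i, 𝔞 X₀ i) = ClassGroup.mk K (∏ i, 𝔠 i) :=
      Lattice.classGroupMk_prod_eq_of_pseudoBasis (L := N) (𝔞 X₀) 𝔠 (b X₀).linearIndependent B.linearIndependent
        (fun v => (hmemN v).symm.trans (hb X₀ v)) hN
    have h2 : ∏ i, 𝔠 i = FractionalIdeal.mk0 K I := by
      rw [Finset.prod_eq_single i₀ (fun j _ hj => by simp only [𝔠, Function.update_of_ne hj])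
        (fun h => absurd (Finset.mem_univ _) h)]
      simp only [𝔠, Function.update_self]
    change ClassGroup.mk K (∏ i, 𝔞 X₀ i) = cl
    rw [h1, h2, ClassGroup.mk_mk0, hI]
  calc Fintype.card (ClassGroup (𝓞 K)) = Nat.card (ClassGroup (𝓞 K)) := Nat.card_eq_fintype_card.symm
    _ ≤ _ := Nat.card_le_card_of_surjective _ hsurj

end LowerBound

/-! ## §3 Endomorphism and matrix language -/

section Endomorphism

/-- **At least `h_{ℚ[x]/(P)}` classes of `T`-stable lattices modulo `C(T)`** for `T` with `P(T) = 0`, `P` irreducible,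
`c(T) = 0` (`c ∈ ℤ[x]` monic), `W ≠ 0` (`K = ℚ[x]/(P)` acting through `T`, `C(T) = GL_K(W)`; the transfer of g38-#4 §6).
[cite: Marseglia2025ModulesOverOrders, §3 Prop. 3.1, Cor. 3.7 (weak form) with §4 Thm. 4.1, chunks p0006–p0009] -/
theorem card_classGroup_le_natCard_quot_centralizer {W : Type*} [AddCommGroup W] [Module ℚ W]
    [FiniteDimensional ℚ W] [Nontrivial W] (T : Module.End ℚ W) {P : ℚ[X]} [hP : Fact (Irreducible P)]
    (hPT : aeval T P = 0) {c : ℤ[X]} (hc : c.Monic) (hcT : aeval T (c.map (Int.castRingHom ℚ)) = 0) :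
    Fintype.card (ClassGroup (𝓞 (AdjoinRoot P))) ≤
      Nat.card (Quot (fun L L' : {L : Submodule ℤ W // L.IsLattice ℚ ∧ ∀ x ∈ L, T x ∈ L} =>
        ∃ φ : W ≃ₗ[ℚ] W, (φ : W →ₗ[ℚ] W) ∘ₗ T = T ∘ₗ (φ : W →ₗ[ℚ] W) ∧
          L.1.map ((φ : W →ₗ[ℚ] W).restrictScalars ℤ) = L'.1)) := by
  classical
  -- `K = ℚ[x]/(P)` acting on `W` through `x ↦ T` (as in g38-#4 §6)
  have hI : ∀ q ∈ Ideal.span ({P} : Set ℚ[X]), aeval T q = 0 := fun q hq => by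
    obtain ⟨r, rfl⟩ := Ideal.mem_span_singleton'.mp hq
    rw [map_mul, hPT, mul_zero]
  let φK : AdjoinRoot P →ₐ[ℚ] Module.End ℚ W := Ideal.Quotient.liftₐ (Ideal.span {P}) (aeval T) hI
  have hφ_mk : ∀ q : ℚ[X], φK (AdjoinRoot.mk P q) = aeval T q := fun q => rfl
  have hφ_root : φK (AdjoinRoot.root P) = T := by
    rw [AdjoinRoot.root, hφ_mk, aeval_X]
  letI : Module (AdjoinRoot P) W := Module.compHom W φK.toRingHom
  have hsmul : ∀ (a : AdjoinRoot P) (w : W), a • w = φK a w := fun _ _ => rfl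
  haveI : IsScalarTower ℚ (AdjoinRoot P) W := IsScalarTower.of_algebraMap_smul fun q w => by
    have halg : ∀ g : ℚ →+* AdjoinRoot P, φK (g q) = algebraMap ℚ (Module.End ℚ W) q := fun g => by
      rw [Subsingleton.elim g ((AdjoinRoot.mk P).comp C), RingHom.comp_apply, hφ_mk, aeval_C]
    rw [hsmul, halg, Module.algebraMap_end_apply]
  have hθ : ∀ w : W, AdjoinRoot.root P • w = T w := fun w => by rw [hsmul, hφ_root]
  have hinj : Function.Injective φK := φK.toRingHom.injective
  have hint : IsIntegral ℤ (AdjoinRoot.root P) := by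
    refine ⟨c, hc, ?_⟩
    rw [← Polynomial.aeval_def, ← Polynomial.aeval_map_algebraMap ℚ (AdjoinRoot.root P) c, algebraMap_int_eq]
    apply hinj
    rw [map_zero, ← Polynomial.aeval_algHom_apply, hφ_root, hcT]
  have hgen : Algebra.adjoin ℚ ({AdjoinRoot.root P} : Set (AdjoinRoot P)) = ⊤ := AdjoinRoot.adjoinRoot_eq_top
  have hle := card_classGroup_le_natCard_quot (K := AdjoinRoot P) (W := W) hint hgen
  -- same lattices, same relation
  set rK := (fun M M' : {M : Submodule ℤ W // M.IsLattice ℚ ∧ ∀ x ∈ M, AdjoinRoot.root P • x ∈ M} =>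
    ∃ φ : W ≃ₗ[AdjoinRoot P] W, M.1.map ((φ : W →ₗ[AdjoinRoot P] W).restrictScalars ℤ) = M'.1) with hrK
  let e : {L : Submodule ℤ W // L.IsLattice ℚ ∧ ∀ x ∈ L, T x ∈ L} ≃
      {M : Submodule ℤ W // M.IsLattice ℚ ∧ ∀ x ∈ M, AdjoinRoot.root P • x ∈ M} :=
    Equiv.subtypeEquivRight fun L => by simp_rw [hθ]
  have hcongr : ∀ L L' : {L : Submodule ℤ W // L.IsLattice ℚ ∧ ∀ x ∈ L, T x ∈ L},
      (∃ φ : W ≃ₗ[ℚ] W, (φ : W →ₗ[ℚ] W) ∘ₗ T = T ∘ₗ (φ : W →ₗ[ℚ] W) ∧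
          L.1.map ((φ : W →ₗ[ℚ] W).restrictScalars ℤ) = L'.1) ↔ rK (e L) (e L') := by
    intro L L'
    constructor
    · rintro ⟨φ, hφT, hmap⟩
      have hTφ : T * (φ : Module.End ℚ W) = (φ : Module.End ℚ W) * T := hφT.symm
      have hcomm : ∀ a : AdjoinRoot P, φK a * (φ : Module.End ℚ W) = (φ : Module.End ℚ W) * φK a := by
        intro a
        induction a using AdjoinRoot.induction_on with
        | ih q => rw [hφ_mk]; exact Literature.LinearAlgebra.aeval_mul_eq_mul_aeval_of_commute hTφ q
      let ψ : W ≃ₗ[AdjoinRoot P] W :=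
        { toFun := φ, invFun := φ.symm, map_add' := fun x y => φ.map_add x y,
          map_smul' := fun a w => by
            rw [RingHom.id_apply, hsmul, hsmul]
            exact (LinearMap.congr_fun (hcomm a) w).symm
          left_inv := φ.left_inv, right_inv := φ.right_inv }
      refine ⟨ψ, ?_⟩
      have hψ : ((ψ : W →ₗ[AdjoinRoot P] W).restrictScalars ℤ) = (φ : W →ₗ[ℚ] W).restrictScalars ℤ :=
        LinearMap.ext fun _ => rfl
      change L.1.map ((ψ : W →ₗ[AdjoinRoot P] W).restrictScalars ℤ) = L'.1
      rw [hψ]; exact hmap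
    · rintro ⟨ψ, hmap⟩
      refine ⟨ψ.restrictScalars ℚ, ?_, ?_⟩
      · ext w
        change ψ (T w) = T (ψ w)
        rw [← hθ, ← hθ, LinearEquiv.map_smul]
      · exact hmap
  rw [← Nat.card_congr (Quot.congr (rb := rK) e hcongr).symm]
  exact hle

/-- **Matrix language**: for any model `(V, T)` with `P(T) = 0` (`P` irreducible), `χ_T = c ∈ ℤ[x]`, `V ≠ 0`, the
`GL_n(ℤ)`-classes of semisimple integer matrices with characteristic polynomial `c` number **at least the class number
of `ℚ[x]/(P)`** (g38-#3's bijection `𝓜/∼_ℤ ≃ 𝓛/≃`; for `c` irreducible and `ℤ[θ] = 𝒪_K` the Latimer–MacDuffee–Taussky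
count from below). [cite: Marseglia2025ModulesOverOrders, §3 Cor. 3.7 (weak form) and §4 Thm. 4.1] [cite: Taussky1949, Thm. 1–2] -/
theorem card_classGroup_le_natCard_quot_conj {V : Type*} [AddCommGroup V] [Module ℚ V] [FiniteDimensional ℚ V]
    [Nontrivial V] {n : ℕ} (hn : finrank ℚ V = n) (T : Module.End ℚ V) {P : ℚ[X]} [hP : Fact (Irreducible P)]
    (hPT : aeval T P = 0) {c : ℤ[X]} (hc : T.charpoly = c.map (Int.castRingHom ℚ)) :
    Fintype.card (ClassGroup (𝓞 (AdjoinRoot P))) ≤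
      Nat.card (Quot (fun B B' : {B : _root_.Matrix (Fin n) (Fin n) ℤ //
          Module.End.IsSemisimple (Matrix.toLin' (B.map (Int.castRingHom ℚ))) ∧ B.charpoly = c} =>
        ∃ Q : _root_.Matrix (Fin n) (Fin n) ℤ, IsUnit Q.det ∧ Q * B.1 = B'.1 * Q)) := by
  have hT : T.IsSemisimple := Module.End.isSemisimple_of_squarefree_aeval_eq_zero hP.out.squarefree hPT
  have hcm : c.Monic := by
    refine Polynomial.monic_of_injective (Int.castRingHom ℚ).injective_int ?_
    rw [← hc]; exact T.charpoly_monic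
  have hcT : aeval T (c.map (Int.castRingHom ℚ)) = 0 := by rw [← hc]; exact T.aeval_self_charpoly
  rw [LatimerMacDuffeeSemisimple.natCard_quot_conj_eq_of_isSemisimple hn T hT hc]
  exact card_classGroup_le_natCard_quot_centralizer T hPT hcm hcT

/-- **Model-free, the isotypic case `χ = P^{s+1}`**: for a monic `P ∈ ℤ[x]` irreducible over `ℚ` and `s ≥ 0`, the
`GL_N(ℤ)`-classes (`N = (s+1)·deg P`) of semisimple integer matrices with characteristic polynomial `P^{s+1}` number
**at least the class number of `ℚ[x]/(P)`** — and finitely many (g38-#5); the model is the integer block-companion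
matrix of g38-#6.  For `s = 0` and `ℤ[x]/(P)` maximal this is the Latimer–MacDuffee–Taussky count from below.
[cite: Marseglia2025ModulesOverOrders, §3 Cor. 3.7 (weak form) and §4 Thm. 4.1] [cite: Taussky1949, Thm. 1–2] [cite: HertlingLarabi2026b, §1 ([Za38]) and Thm. 6.2] -/
theorem card_classGroup_le_natCard_quot_conj_pow (P : ℤ[X]) (hP : P.Monic)
    [hirr : Fact (Irreducible (P.map (Int.castRingHom ℚ)))] (s : ℕ) :
    Fintype.card (ClassGroup (𝓞 (AdjoinRoot (P.map (Int.castRingHom ℚ))))) ≤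
      Nat.card (Quot (fun B B' : {B : _root_.Matrix (Fin ((s + 1) * P.natDegree)) (Fin ((s + 1) * P.natDegree)) ℤ //
          Module.End.IsSemisimple (Matrix.toLin' (B.map (Int.castRingHom ℚ))) ∧ B.charpoly = P ^ (s + 1)} =>
        ∃ Q : _root_.Matrix (Fin ((s + 1) * P.natDegree)) (Fin ((s + 1) * P.natDegree)) ℤ,
          IsUnit Q.det ∧ Q * B.1 = B'.1 * Q)) := by
  obtain ⟨⟨B₀, hmin, hchar⟩⟩ := IntegerBlockCompanionMatrices.nonempty_minpoly_charpoly_pow P hP s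
  have hdeg : 0 < P.natDegree := by
    rw [← hP.natDegree_map (Int.castRingHom ℚ)]
    exact Polynomial.natDegree_pos_iff_degree_pos.mpr (Polynomial.degree_pos_of_irreducible hirr.out)
  haveI : Nonempty (Fin ((s + 1) * P.natDegree)) := ⟨⟨0, Nat.mul_pos (Nat.succ_pos s) hdeg⟩⟩
  -- the model `(ℚ^N, B₀)`
  have hPT : aeval (Matrix.toLin' (B₀.map (Int.castRingHom ℚ))) (P.map (Int.castRingHom ℚ)) = 0 := by
    rw [← hmin, ← Matrix.minpoly_toLin']
    exact minpoly.aeval ℚ _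
  have hc : (Matrix.toLin' (B₀.map (Int.castRingHom ℚ))).charpoly = (P ^ (s + 1)).map (Int.castRingHom ℚ) := by
    rw [Matrix.charpoly_toLin', Matrix.charpoly_map, hchar]
  exact card_classGroup_le_natCard_quot_conj (Module.finrank_fin_fun ℚ) _ hPT hc

end Endomorphism

end Literature.LinearAlgebra.Matrix.StableLatticeClassesLowerBound
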